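import Mathlib
import HarnessLib
import Summits.NavierStokesRegularity.NavierStokesRegularity.Theorems.HalfSpaceWindowDoorCirculationCarryingRigidityConeFluxSubsolution
import Summits.NavierStokesRegularity.NavierStokesRegularity.Theorems.HalfSpaceWindowDoorCirculationCarryingRigidityAngularMeanDrift
import Literature.Analysis.FluidPDE.MeridianReduction

/-!
# Route `HalfSpaceWindowDoor`, crux `CirculationCarryingRigidity` (stmt-NavierStokesRegularity-25311) —
# line `eddy_covariance`, kinematics: the circle means `v̄_r`, `v̄_z` in the TIME-ONLY class and the vertical derivative of `F = (2π)⁻¹Γ`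

LEAD ns-hsw-p1 g10, `--supports stmt-NavierStokesRegularity-25311 --as helper`; card `Cruxes/…/Lines/eddy_covariance.md`.
Three small tools for the eddy form of the sweeping lemma (`…EddyBarrier`, `…EddySweeping`): in the time-only Type-I class
(`‖v(t)‖_∞ ≤ C/√(−t)`) the circle means of the radial and vertical velocity obey `|v̄_r|, |v̄_z| ≤ C/√(−t)` (`abs_meanR_le`,
`abs_meanZ_le` — g4's `…AngularMeanDrift` bounded them only in the axis-Type-I subclass), and off the axis
`DF(s,·)(x)[e_z] = (2π)⁻¹Γ_z = −(2π)⁻¹∮_{S(|x_h|,x₂)} ω_r dl` (`fderiv_circF_eZ`; gradient of the lift and `Γ_z = −∮ω_r dl`).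
With these the MEAN ADVECTION `v̄_r Γ_r + v̄_z Γ_z` of the circle law in remainder form
(`…AngularMeanDrift.deriv_circ_s_eq_remainder`) becomes a bounded drift term `DF[v̄_r e_r + v̄_z e_z]` for the whole-space maximum principle.
WHAT THIS IS NOT: not about NS regularity; kinematics of HYPOTHETICAL blow-up profiles.  No item is closed by this file.
-/

noncomputable section

-- the summit and its single sub-problem share the name (CONVENTIONS §1), as in every Theorems file
set_option linter.dupNamespace false

namespace Summit.NavierStokesRegularity.NavierStokesRegularity.Theorems.HalfSpaceWindowDoorCirculationCarryingRigidityEddyMeans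

open MeasureTheory Set Function Filter Topology InnerProductSpace
open scoped RealInnerProductSpace InnerProductSpace Laplacian
open Literature.Analysis Literature.Analysis.UnboundedOperators
open Literature.Analysis.FluidPDE hiding eR
open Summit.NavierStokesRegularity.NavierStokesRegularity.Theorems.HalfSpaceWindowDoorCirculationCarryingRigidityDefs
  (InDoorClass SignE3 e3)
open Summit.NavierStokesRegularity.NavierStokesRegularity.Theorems.AxisTwistDoorAveragedConeLiouvilleDefs
  (cylPt eT eR circ vortCirc radVortCirc tiltCirc circleTerm meanR meanZ remainder)
open Summit.NavierStokesRegularity.NavierStokesRegularity.Theorems.AveragedConeLiouville.CircleStokes (continuous_eR)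
open Summit.NavierStokesRegularity.NavierStokesRegularity.Theorems.AxisTwistDoorAveragedConeLiouvilleCylFrame
  (continuous_cylPt_θ abs_inner_eR_le abs_inner_e3_le abs_integral_le_const_mul_add norm_eR)
open Summit.NavierStokesRegularity.NavierStokesRegularity.Theorems.AveragedConeLiouville.CircleStokes
  (deriv_circ_eq_vortCirc)
open Summit.NavierStokesRegularity.NavierStokesRegularity.Theorems.AveragedConeLiouville.CircleCalculus (deriv_circ_z)
open Summit.NavierStokesRegularity.NavierStokesRegularity.Theorems.AveragedConeLiouville.CircMonotone
  (circ_zero circ_mono circ_nonneg vortCirc_nonneg)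
open Summit.NavierStokesRegularity.NavierStokesRegularity.Theorems.HalfSpaceWindowDoorCirculationCarryingRigidityAxisCirculation
  (contDiff_circF isSmoothSpaceTimeOn_circF isSmoothSpaceTimeOn_of_class fderiv_circF_eR laplacian_circF hasDerivAt_circF_time
    contDiffOn_circ)
open Summit.NavierStokesRegularity.NavierStokesRegularity.Theorems.AxisTwistDoorAveragedConeLiouvilleAxisLift
  (lift gradient_lift contDiffAt_lift)

open Summit.NavierStokesRegularity.NavierStokesRegularity.Theorems.HalfSpaceWindowDoorCirculationCarryingRigidityConeFluxSubsolution


variable {C : ℝ} {v : ℝ → EuclideanSpace ℝ (Fin 3) → EuclideanSpace ℝ (Fin 3)}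

/-! ### The circle means of `v_r`, `v_z` in the time-only class, and the vertical derivative of `F = (2π)⁻¹Γ` -/

/-- `|v̄_r(r,z,t)| ≤ C/√(−t)` in the time-only class (circle mean of `⟪v, e_r⟫`, `|⟪v,e_r⟫| ≤ ‖v‖ ≤ C/√(−t)`). -/
theorem abs_meanR_le (hv : InDoorClass C v) {t : ℝ} (ht : t < 0) (r z : ℝ) :
    |meanR v r z t| ≤ C / Real.sqrt (-t) := by
  have h2π : (0 : ℝ) ≤ 2 * Real.pi := by positivity
  have hb : ∀ θ ∈ Set.uIoc (0 : ℝ) (2 * Real.pi), ‖⟪v t (cylPt r θ z), eR θ⟫_ℝ‖ ≤ C / Real.sqrt (-t) := by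
    intro θ _
    rw [Real.norm_eq_abs]
    exact (abs_inner_eR_le _ θ).trans (hv.1 t ht _)
  have h := intervalIntegral.norm_integral_le_of_norm_le_const hb
  rw [Real.norm_eq_abs] at h
  rw [meanR, abs_mul, abs_inv, abs_of_pos (by positivity : (0:ℝ) < 2 * Real.pi)]
  calc (2 * Real.pi)⁻¹ * |∫ θ in (0 : ℝ)..(2 * Real.pi), ⟪v t (cylPt r θ z), eR θ⟫_ℝ|
      ≤ (2 * Real.pi)⁻¹ * (C / Real.sqrt (-t) * |2 * Real.pi - 0|) := by gcongr
    _ = C / Real.sqrt (-t) := by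
        rw [sub_zero, abs_of_pos (by positivity : (0:ℝ) < 2 * Real.pi)]
        field_simp

/-- `|v̄_z(r,z,t)| ≤ C/√(−t)` in the time-only class. -/
theorem abs_meanZ_le (hv : InDoorClass C v) {t : ℝ} (ht : t < 0) (r z : ℝ) :
    |meanZ v r z t| ≤ C / Real.sqrt (-t) := by
  have hb : ∀ θ ∈ Set.uIoc (0 : ℝ) (2 * Real.pi),
      ‖⟪v t (cylPt r θ z), Summit.NavierStokesRegularity.NavierStokesRegularity.Theorems.AxisTwistDoorAveragedConeLiouvilleDefs.e3⟫_ℝ‖ ≤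
        C / Real.sqrt (-t) := by
    intro θ _
    rw [Real.norm_eq_abs]
    exact (abs_inner_e3_le _).trans (hv.1 t ht _)
  have h := intervalIntegral.norm_integral_le_of_norm_le_const hb
  rw [Real.norm_eq_abs] at h
  rw [meanZ, abs_mul, abs_inv, abs_of_pos (by positivity : (0:ℝ) < 2 * Real.pi)]
  calc (2 * Real.pi)⁻¹ * |∫ θ in (0 : ℝ)..(2 * Real.pi),
        ⟪v t (cylPt r θ z), Summit.NavierStokesRegularity.NavierStokesRegularity.Theorems.AxisTwistDoorAveragedConeLiouvilleDefs.e3⟫_ℝ|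
      ≤ (2 * Real.pi)⁻¹ * (C / Real.sqrt (-t) * |2 * Real.pi - 0|) := by gcongr
    _ = C / Real.sqrt (-t) := by
        rw [sub_zero, abs_of_pos (by positivity : (0:ℝ) < 2 * Real.pi)]
        field_simp

/-- **The vertical derivative of `F` is `−(2π)⁻¹ ∮ω_r dl`**: `DF(s,·)(x)[e_z] = (2π)⁻¹ Γ_z = −(2π)⁻¹ ∮_{S(|x_h|,x₂)} ω_r dl`
(gradient of the lift, `⟪e_r, e_z⟫ = 0`, `⟪e_z, e_z⟫ = 1`, and `Γ_z = −∮ω_r dl`), off the axis. -/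
theorem fderiv_circF_eZ (hv : IsSmoothSpaceTimeOn (Iio (0 : ℝ)) v) {s : ℝ} (hs : s < 0) {x : EuclideanSpace ℝ (Fin 3)}
    (hx : cylRadius x ≠ 0) :
    fderiv ℝ (fun y : EuclideanSpace ℝ (Fin 3) => (2 * Real.pi)⁻¹ * circ v (cylRadius y) (y 2) s) x eZ =
      -((2 * Real.pi)⁻¹ * radVortCirc v (cylRadius x) (x 2) s) := by
  have hΓ := contDiffOn_circ hv
  have hv1 : ContDiff ℝ 1 (v s) := (hv.contDiff_slice hs).of_le (by norm_cast)
  have hfun : (fun y : EuclideanSpace ℝ (Fin 3) => (2 * Real.pi)⁻¹ * circ v (cylRadius y) (y 2) s) =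
      fun y => (2 * Real.pi)⁻¹ * lift (circ v) s y := rfl
  have hd : DifferentiableAt ℝ (lift (circ v) s) x :=
    (contDiffAt_lift hΓ hs hx).differentiableAt (by norm_num)
  rw [hfun, fderiv_const_mul hd, _root_.smul_apply, smul_eq_mul, ← mul_neg]
  congr 1
  have hgrad := gradient_lift hΓ hs hx
  have hinner : fderiv ℝ (lift (circ v) s) x eZ = ⟪gradient (lift (circ v) s) x, eZ⟫_ℝ := by
    rw [gradient, InnerProductSpace.toDual_symm_apply]
  have heZ : ⟪(eZ : EuclideanSpace ℝ (Fin 3)), eZ⟫_ℝ = 1 := by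
    rw [eZ, EuclideanSpace.inner_single_left]; simp
  rw [hinner, hgrad, inner_add_left, real_inner_smul_left, real_inner_smul_left, inner_eR_eZ, heZ, mul_zero, zero_add,
    mul_one, deriv_circ_z v hv1]

/-! ### Upper bound of the comparison function (class bound only) -/

/-- **The comparison `(2π)⁻¹(Γ − μ − A|x_h|²/(√(−t)√(−s₀)))` is bounded above on `[s₀,s₁] × ℝ³`** by `π(C/√(−s₁))²(−s₀)/(2A)`
(`Γ(ρ,z,t) ≤ 2πρC/√(−t)` by Stokes and the Type-I rate, and `2πρa − Aρ²/u ≤ π²a²u/A`). -/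
theorem barrier_upper_bound (hv : InDoorClass C v) {μ A s₀ s₁ : ℝ} (hμ0 : 0 ≤ μ) (hApos : 0 < A) (hs₀₁ : s₀ < s₁) (hs₁ : s₁ < 0)
    {t : ℝ} (ht : t ∈ Icc s₀ s₁) (x : EuclideanSpace ℝ (Fin 3)) :
    (2 * Real.pi)⁻¹ * circ v (cylRadius x) (x 2) t -
        (2 * Real.pi)⁻¹ * (μ + A * (Real.sqrt (-t) * Real.sqrt (-s₀))⁻¹ * (x 0 * x 0 + x 1 * x 1)) ≤
      Real.pi * (C / Real.sqrt (-s₁)) ^ 2 * (-s₀) / (2 * A) := by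
  have hs₀ : s₀ < 0 := hs₀₁.trans hs₁
  have hsq₀ : 0 < Real.sqrt (-s₀) := Real.sqrt_pos.2 (neg_pos.2 hs₀)
  have hsq₁ : 0 < Real.sqrt (-s₁) := Real.sqrt_pos.2 (neg_pos.2 hs₁)
  have hC : 0 ≤ C := HalfSpaceWindowDoorCirculationCarryingRigidityConeFluxSubsolution.typeI_const_nonneg hv
  have ht0 : t < 0 := lt_of_le_of_lt ht.2 hs₁
  have hsqt : 0 < Real.sqrt (-t) := Real.sqrt_pos.2 (neg_pos.2 ht0)
  set ρ := cylRadius x with hρ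
  have hρ0 : 0 ≤ ρ := cylRadius_nonneg x
  have hρ2 : ρ ^ 2 = x 0 * x 0 + x 1 * x 1 := by rw [cylRadius_sq x]; ring
  set a : ℝ := C / Real.sqrt (-s₁) with ha
  have h1 : circ v ρ (x 2) t ≤ 2 * Real.pi * ρ * a := by
    refine (circ_le_linear hv ht0 hρ0 (x 2)).trans ?_
    have : C / Real.sqrt (-t) ≤ C / Real.sqrt (-s₁) :=
      div_le_div_of_nonneg_left hC hsq₁ (Real.sqrt_le_sqrt (by linarith [ht.2]))
    exact mul_le_mul_of_nonneg_left this (by positivity)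
  set u : ℝ := -s₀ with hu
  have hu0 : 0 < u := neg_pos.2 hs₀
  have h2 : A * ρ ^ 2 / u ≤ A * (Real.sqrt (-t) * Real.sqrt (-s₀))⁻¹ * (x 0 * x 0 + x 1 * x 1) := by
    rw [← hρ2, div_eq_mul_inv, mul_assoc, mul_comm (ρ ^ 2), ← mul_assoc]
    refine mul_le_mul_of_nonneg_right (mul_le_mul_of_nonneg_left ?_ hApos.le) (sq_nonneg _)
    have hst : Real.sqrt (-t) * Real.sqrt (-s₀) ≤ u := by
      have h' : Real.sqrt (-t) ≤ Real.sqrt (-s₀) := Real.sqrt_le_sqrt (by linarith [ht.1])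
      calc Real.sqrt (-t) * Real.sqrt (-s₀) ≤ Real.sqrt (-s₀) * Real.sqrt (-s₀) := mul_le_mul_of_nonneg_right h' hsq₀.le
        _ = u := Real.mul_self_sqrt hu0.le
    exact inv_anti₀ (by positivity) hst
  have hkey : 2 * Real.pi * ρ * a - A * ρ ^ 2 / u ≤ Real.pi ^ 2 * a ^ 2 * u / A := quad_sub_sq_le hApos hu0 ρ a
  rw [← mul_sub]
  have e2 : Real.pi * a ^ 2 * u / (2 * A) = (2 * Real.pi)⁻¹ * (Real.pi ^ 2 * a ^ 2 * u / A) := by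
    field_simp
  rw [e2]
  refine mul_le_mul_of_nonneg_left ?_ (by positivity)
  linarith

end Summit.NavierStokesRegularity.NavierStokesRegularity.Theorems.HalfSpaceWindowDoorCirculationCarryingRigidityEddyMeans

end
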